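import Literature.IUT.HodgeTheaters.PMBaseStrips

/-!
# Proofs over [IUTchI] Def 6.1 (iii), (iv): signs of automorphisms and `+`-full poly-isomorphisms

Mochizuki, *Inter-universal Teichmüller theory I*, §6, Definition 6.1 (iii), (iv), kurims manuscript
(May 2020) p. 157. PROOF-ONLY companion (theorems, no definitions) to abc-iut-L5-t4's
`PMBaseStrips.lean`, by the L5 discharge seat abc-iut-L5-t13. Contents:

* the sign calculus of "the natural surjection `Aut(†𝒟_v) ↠ {±1}`" over the interface `PMBaseKit`
  (Def 6.1 (iii)): signs of composites and inverses, conjugation invariance of positivity;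
* membership in `Aut^α(†𝔇)` (`DStrip.signedPolyAut`) and in a `+`-full poly-isomorphism
  (`DStrip.plusFullPolyIso`), read off from the induced bijections of `±`-label classes;
* **Def 6.1 (iv), last clause — DISCHARGED**: "if `†𝔇 = ‡𝔇`, then the set of `+`-full
  poly-isomorphisms `†𝔇 ⥲ ‡𝔇` is in natural bijective correspondence with the set `{±1}^𝕍`" — the
  named statement `DStrip.PlusFullPolyAutEquivSigns` of `PMBaseStrips.lean` holds for every
  `𝒟`-prime-strip (`DStrip.plusFullPolyAutEquivSigns`);
* the equality criterion for `+`-full poly-isomorphisms (composition and conjugation, which need the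
  capsule vocabulary of `PMBaseModels.lean`, are in `PMBaseModelsProofs.lean`).

Record only; [claim: Mochizuki2012, status: disputed]; nothing here takes a side on any disputed step.
-/

namespace Literature.IUT.HodgeTheaters

open CategoryTheory

universe u

namespace PMBaseKit

variable {l : ℕ} {K : PMBaseKit.{u} l}

/-! ### Sign calculus at one `v` ([IUTchI] Def 6.1 (iii) p. 157) -/

section Signs

variable {v : K.V} {X Y : K.Amb v}

/-- `z ↦ −z` on `LabCusp^±(†𝒟_v)` is an involution. [claim: Mochizuki2012, status: disputed] -/
theorem labNeg_trans_labNeg (hX : K.IsLocal v X) : (labNeg hX).trans (labNeg hX) = Equiv.refl _ := by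
  ext x
  simp [labNeg]

/-- The sign of a composite of automorphisms of an isomorph `†𝒟_v` is the product of the signs: `α ≫ β`
is positive iff `α`, `β` have the same sign ("natural surjection `Aut(†𝒟_v) ↠ {±1}`", [IUTchI] Def 6.1
(iii) p. 157). [claim: Mochizuki2012, status: disputed] -/
theorem labMap_trans_eq_refl_iff (hX : K.IsLocal v X) (α β : X ≅ X) :
    K.labMap v (α ≪≫ β) = Equiv.refl _ ↔ (K.labMap v α = Equiv.refl _ ↔ K.labMap v β = Equiv.refl _) := by
  have hne := labNeg_ne_refl hX
  rw [K.labMap_trans]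
  rcases labMap_eq_refl_or_labNeg hX α with ha | ha <;> rcases labMap_eq_refl_or_labNeg hX β with hb | hb <;>
    rw [ha, hb]
  · simp
  · rw [Equiv.refl_trans]
    exact ⟨fun h => absurd h hne, fun h => absurd (h.mp rfl) hne⟩
  · rw [Equiv.trans_refl]
    exact ⟨fun h => absurd h hne, fun h => absurd (h.mpr rfl) hne⟩
  · rw [labNeg_trans_labNeg hX]
    exact ⟨fun _ => ⟨fun h => absurd h hne, fun h => absurd h hne⟩, fun _ => rfl⟩

/-- Two isomorphisms `φ, ψ : †𝒟_v ⥲ ‡𝒟_v` induce the same bijection on `±`-label classes iff `φ⁻¹ ∘ ψ` is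
positive. [claim: Mochizuki2012, status: disputed] -/
theorem labMap_symm_trans_eq_refl_iff (φ ψ : X ≅ Y) :
    K.labMap v (φ.symm ≪≫ ψ) = Equiv.refl _ ↔ K.labMap v φ = K.labMap v ψ := by
  rw [K.labMap_trans, labMap_symm]
  constructor
  · intro h
    have h' := congrArg (fun e => (K.labMap v φ).trans e) h
    simp only [← Equiv.trans_assoc, Equiv.self_trans_symm, Equiv.refl_trans, Equiv.trans_refl] at h'
    exact h'.symm
  · intro h
    rw [h, Equiv.symm_trans_self]

/-- Positivity is invariant under conjugation by an isomorphism `φ : †𝒟_v ⥲ ‡𝒟_v` (functoriality of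
`LabCusp^±`, [IUTchI] Def 6.1 (iii) p. 156 "constructed solely from `†𝒟_v`").
[claim: Mochizuki2012, status: disputed] -/
theorem labMap_conj_eq_refl_iff (φ : X ≅ Y) (b : X ≅ X) :
    K.labMap v (φ.symm ≪≫ b ≪≫ φ) = Equiv.refl _ ↔ K.labMap v b = Equiv.refl _ := by
  rw [K.labMap_trans, K.labMap_trans, labMap_symm]
  constructor
  · intro h
    ext x
    have hx := congrArg (fun e => e (K.labMap v φ x)) h
    simp only [Equiv.trans_apply, Equiv.symm_apply_apply, Equiv.refl_apply] at hx
    exact (K.labMap v φ).injective hx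
  · intro h
    rw [h, Equiv.refl_trans, Equiv.symm_trans_self]

end Signs

/-! ### `Aut^α(†𝔇)` and `+`-full poly-isomorphisms of `𝒟`-prime-strips, via signs -/

namespace DStrip

variable {D D₁ D₂ D₃ : K.DStrip}

/-- Membership in `Aut^α(†𝔇)`: the component at `v` is positive exactly when `α(v) = +1` ([IUTchI] Def
6.1 (iii) p. 157). [claim: Mochizuki2012, status: disputed] -/
theorem mem_signedPolyAut_iff (α : K.V → ℤˣ) (β : D.Iso D) :
    β ∈ D.signedPolyAut α ↔ ∀ v, (K.labMap v (β v) = Equiv.refl _ ↔ α v = 1) := by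
  change (∀ v, (α v = 1 → K.labMap v (β v) = Equiv.refl _) ∧
    (α v = -1 → ¬ K.labMap v (β v) = Equiv.refl _)) ↔ _
  refine forall_congr' fun v => ?_
  rcases Int.units_eq_one_or (α v) with h | h <;> rw [h]
  · simp
  · have h1 : ((-1 : ℤˣ) = 1) ↔ False := ⟨fun h => absurd h (by decide), False.elim⟩
    simp [h1]

/-- `Aut^α(†𝔇)` is nonempty for every `α ∈ {±1}^𝕍` (negative automorphisms exist at every `v`, [IUTchI]
Def 6.1 (iii) p. 157). [claim: Mochizuki2012, status: disputed] -/
theorem exists_mem_signedPolyAut (D : K.DStrip) (α : K.V → ℤˣ) : ∃ β, β ∈ D.signedPolyAut α := by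
  have h : ∀ v, ∃ b : D.obj v ≅ D.obj v, (K.labMap v b = Equiv.refl _ ↔ α v = 1) := by
    intro v
    rcases Int.units_eq_one_or (α v) with h | h
    · exact ⟨CategoryTheory.Iso.refl _, by rw [K.labMap_refl, h]; simp⟩
    · obtain ⟨a, ha⟩ := K.exists_negative v (D.obj v) (D.isLocal v)
      refine ⟨a, ⟨fun h' => absurd h' ha, fun h' => ?_⟩⟩
      rw [h] at h'
      exact absurd h' (by decide)
  choose β hβ using h
  exact ⟨β, (mem_signedPolyAut_iff α β).mpr hβ⟩

/-- Members of a `+`-full poly-isomorphism `†𝔇 ⥲ ‡𝔇` induce, at every `v`, the same bijection of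
`±`-label classes (they differ by `Aut_+(‡𝔇)`, which acts trivially).
[claim: Mochizuki2012, status: disputed] -/
theorem mem_plusFullPolyIso_iff {φ ψ : D₁.Iso D₂} :
    ψ ∈ DStrip.plusFullPolyIso φ ↔ ∀ v, K.labMap v (ψ v) = K.labMap v (φ v) := by
  constructor
  · rintro ⟨a, ha, rfl⟩ v
    have hav : K.labMap v (a v) = Equiv.refl _ := (K.mem_autPlus_iff _).mp ((D₂.mem_autPlus_iff a).mp ha v)
    rw [K.labMap_trans, hav, Equiv.trans_refl]
  · intro h
    refine ⟨fun v => (φ v).symm ≪≫ ψ v, (D₂.mem_autPlus_iff _).mpr fun v => ?_, funext fun v => by simp⟩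
    show K.labMap v ((φ v).symm ≪≫ ψ v) = Equiv.refl _
    rw [labMap_symm_trans_eq_refl_iff]
    exact (h v).symm

/-- Every isomorphism lies in its own `+`-full poly-isomorphism. [claim: Mochizuki2012, status: disputed] -/
theorem self_mem_plusFullPolyIso (φ : D₁.Iso D₂) : φ ∈ DStrip.plusFullPolyIso φ :=
  mem_plusFullPolyIso_iff.mpr fun _ => rfl

/-- Two isomorphisms span the same `+`-full poly-isomorphism iff they induce the same bijections of
`±`-label classes at every `v`. [claim: Mochizuki2012, status: disputed] -/
theorem plusFullPolyIso_eq_iff {φ φ' : D₁.Iso D₂} :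
    DStrip.plusFullPolyIso φ = DStrip.plusFullPolyIso φ' ↔ ∀ v, K.labMap v (φ v) = K.labMap v (φ' v) := by
  constructor
  · intro h
    have h' := self_mem_plusFullPolyIso φ
    rw [h] at h'
    exact mem_plusFullPolyIso_iff.mp h'
  · intro h
    ext ψ
    rw [mem_plusFullPolyIso_iff, mem_plusFullPolyIso_iff]
    exact forall_congr' fun v => by rw [h v]

/-- `Aut^α(†𝔇)` is the `+`-full poly-automorphism spanned by any of its members ([IUTchI] Def 6.1 (iv)
p. 157 "the `α`-signed `+`-full poly-isomorphism"). [claim: Mochizuki2012, status: disputed] -/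
theorem signedPolyAut_eq_plusFullPolyIso {α : K.V → ℤˣ} {φ : D.Iso D} (hφ : φ ∈ D.signedPolyAut α) :
    D.signedPolyAut α = DStrip.plusFullPolyIso φ := by
  rw [mem_signedPolyAut_iff] at hφ
  ext β
  rw [mem_signedPolyAut_iff, mem_plusFullPolyIso_iff]
  refine forall_congr' fun v => ?_
  rw [← hφ v]
  rcases labMap_eq_refl_or_labNeg (D.isLocal v) (φ v) with h | h <;> rw [h]
  · simp
  · rw [← labMap_ne_refl_iff (D.isLocal v) (β v)]
    have hF : (labNeg (D.isLocal v) = Equiv.refl _) ↔ False := ⟨labNeg_ne_refl _, False.elim⟩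
    rw [hF]
    exact ⟨fun hh => fun hb => hh.mp hb, fun hh => ⟨fun hb => hh hb, False.elim⟩⟩

/-- **`Aut^α(†𝔇)` is a `+`-full poly-isomorphism** (first clause of the bijection of [IUTchI] Def 6.1
(iv) p. 157). [claim: Mochizuki2012, status: disputed] -/
theorem isPlusFullPolyIso_signedPolyAut (D : K.DStrip) (α : K.V → ℤˣ) :
    DStrip.IsPlusFullPolyIso (D.signedPolyAut α) := by
  obtain ⟨φ, hφ⟩ := exists_mem_signedPolyAut D α
  exact ⟨φ, signedPolyAut_eq_plusFullPolyIso hφ⟩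

/-- **Every `+`-full poly-automorphism of `†𝔇` is `Aut^α(†𝔇)` for some `α ∈ {±1}^𝕍`** (surjectivity in
[IUTchI] Def 6.1 (iv) p. 157): `α(v)` is the sign of any member at `v`.
[claim: Mochizuki2012, status: disputed] -/
theorem exists_eq_signedPolyAut {P : Set (D.Iso D)} (hP : DStrip.IsPlusFullPolyIso P) :
    ∃ α, P = D.signedPolyAut α := by
  classical
  obtain ⟨φ, rfl⟩ := hP
  refine ⟨fun v => if K.labMap v (φ v) = Equiv.refl _ then 1 else -1, ?_⟩
  symm
  apply signedPolyAut_eq_plusFullPolyIso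
  rw [mem_signedPolyAut_iff]
  intro v
  by_cases h : K.labMap v (φ v) = Equiv.refl _
  · simp [h]
  · simp only [h, false_iff, if_false]
    decide

/-- **`α ↦ Aut^α(†𝔇)` is injective** ([IUTchI] Def 6.1 (iv) p. 157). [claim: Mochizuki2012, status: disputed] -/
theorem signedPolyAut_injective (D : K.DStrip) : Function.Injective D.signedPolyAut := by
  intro α α' h
  obtain ⟨φ, hφ⟩ := exists_mem_signedPolyAut D α
  have hφ' : φ ∈ D.signedPolyAut α' := h ▸ hφ
  rw [mem_signedPolyAut_iff] at hφ hφ'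
  funext v
  rcases Int.units_eq_one_or (α v) with h1 | h1 <;> rcases Int.units_eq_one_or (α' v) with h2 | h2 <;>
    rw [h1, h2]
  · exact absurd ((hφ v).mpr h1) (fun hh => absurd ((hφ' v).mp hh) (by rw [h2]; decide))
  · exact absurd ((hφ' v).mpr h2) (fun hh => absurd ((hφ v).mp hh) (by rw [h1]; decide))

/-- **[IUTchI] Def 6.1 (iv), last clause — DISCHARGED**: "if `†𝔇 = ‡𝔇`, then the set of `+`-full
poly-isomorphisms `†𝔇 ⥲ ‡𝔇` is in natural bijective correspondence with the set `{±1}^𝕍`" — the named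
statement `DStrip.PlusFullPolyAutEquivSigns` of `PMBaseStrips.lean` holds for every `𝒟`-prime-strip
over every base kit. [claim: Mochizuki2012, status: disputed] -/
theorem plusFullPolyAutEquivSigns (D : K.DStrip) : D.PlusFullPolyAutEquivSigns :=
  ⟨isPlusFullPolyIso_signedPolyAut D, signedPolyAut_injective D, fun _ hP => exists_eq_signedPolyAut hP⟩

end DStrip

end PMBaseKit

end Literature.IUT.HodgeTheaters
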